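import Summits.HodgeConjecture.HodgeConjecture.Theorems.K2E5QuatPoissonDilation       -- ★ ED. 2 (p855630): `quatCoord_dilate`, `dilate_inv_dilate`, `dilate_dilate_inv`, `continuous_dilate`
import Literature.NumberTheory.Automorphic.AdelicMatrixPoisson                          -- ★ `archHom` (+ ★ `AdelicPiSchwartzBruhatFourier`: `piSchwartzBruhat`, `piArch`, `piFinite`)
import HarnessLib

/-!
# K2 ∕ E5 «TamagawaUnitary», unit G «ZETA» — G3-support ED. 3 `K2E5QuatSchwartzBruhatDilate`: `𝒮(D_{h,𝔸})` is stable under `Φ ↦ Φ(x · )`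

Cell `hodgecm-mathlib` (Track B «K2-LIT»), item h413 = `stmt-HodgeConjecture-24833`; continuation of DEALS E5 BATCH #8 (h) (K2E5-plan (g0), 2026-09-03T23:12:18Z)
to base K2E5-p14, after ★ ED. 1 `K2E5QuatPoissonTransport` (p855575: Poisson on `D_h ⊂ D_{h,𝔸}`) and ★ ED. 2 `K2E5QuatPoissonDilation` (p855630: the module of
`y ↦ x·y` is `quatModule x`); author K2E5-p14 (g0).  PROOF lane (theorems only, `--supports stmt-HodgeConjecture-24833 --as helper`).  This is the hypothesis
under which ED. 1 applies to the DILATED test function `y ↦ Φ(x·y)` in Tate's unfolding of the zeta integral of `D_h` (socket G3 `Zeta.sig_K2E5QuatZetaResidue`).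

Content:
* §1 (generic, `K` any number field, `ι` finite) **`comp_mulVec_mem_piSchwartzBruhat`** — **the Schwartz–Bruhat space `𝒮(𝔸_K^ι)` (★ `piSchwartzBruhat K ι`) is stable
  under every invertible `𝔸_K`-linear change of variables `v ↦ M v`** (`M, M⁻¹ ∈ M_ι(𝔸_K)`).  On a generator `Φ = Φ_∞ ⊗ Φ_f` the archimedean part becomes
  `Φ_∞ ∘ M_∞` with `M_∞ = archHom(M)` an ℝ-linear automorphism of `(K ⊗ ℝ)^ι` (Mathlib `SchwartzMap.compCLMOfContinuousLinearEquiv`), the finite part `Φ_f ∘ M_f`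
  with `M_f` a homeomorphism of `(𝔸_K^∞)^ι` (locally constant, compact support); the coordinates intertwine by `RingHom.map_mulVec` (`piArch_mulVec` and its finite twin).  This extends ★ `comp_equiv_mem_piSchwartzBruhat` (coordinate permutations) and the matrix-space twists ★ `comp_mul_mul_mem_schwartzBruhatAdelicMatrix`.
* §2 (the quaternion algebra `D_h`) the coordinate dilation `T_x a = quatCoordInv (x · quatCoord e a)` of ★ ED. 2 is `𝔸⁺`-LINEAR (`dilate_add`, `dilate_smul`:
  ★ `quatCoord_smul`, ★ `quatCoordEquiv`), hence `T_x a = M_x a` for its matrix `M_x ∈ GL₄(𝔸⁺)` (Mathlib `LinearMap.toMatrix'`), and therefore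
  **`comp_mul_left_mem_quatSchwartzBruhat`**: `Φ ∈ quatSchwartzBruhat L e ⇒ (X ↦ Φ(x · X)) ∈ quatSchwartzBruhat L e` for every unit `x ∈ (D_h ⊗ 𝔸)^×`.

HONEST LABEL: HC_CM is proved only modulo the 7 printed citations (2 remaining named inputs: hLiu418 = stmt-HodgeConjecture-24832,
h413 = stmt-HodgeConjecture-24833) until rung 0 closes; this file is a support lemma for socket G3 of ONE tier-1 unit and discharges no socket by itself.

AUDIT (materialised pages; `book:vignerasnd-arithmetique-des-algebres-de-quaternions` = V80): V80 p0062.txt (Ch. III §2, proof of Thm. 2.2: the Schwartz–Bruhat functions `Φ`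
on `X_A` and the substitution `y ↦ xy` in `Z_X(Φ, s)`); [WeilBNT1967, Ch. VII §2]: standard functions on `X_A` are stable under automorphisms of `X_A`.

## References
* [WeilBNT1967] A. Weil, *Basic Number Theory* (1967) — Ch. VII §2 (standard functions, Prop. 2 and its corollaries: stability under `X_A`-automorphisms).
* [VignerasLNM800] M.-F. Vignéras, *Arithmétique des algèbres de quaternions*, LNM 800 (1980) — Ch. II §4 (fonctions de Schwartz–Bruhat), Ch. III §2.
* [CasselsFrohlichANT1967] J. Tate, Ch. XV §3.2, §4.2 (the class of functions `𝔷`).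
-/

set_option autoImplicit false
set_option linter.dupNamespace false

noncomputable section

namespace Summit.HodgeConjecture.HodgeConjecture.Cruxes.H413.K2E5QuatSchwartzBruhatDilate

open NumberField NumberField.InfinitePlace NumberField.mixedEmbedding IsDedekindDomain
open Literature.NumberTheory.Automorphic
open Summit.HodgeConjecture.HodgeConjecture.Cruxes.H413.K2E5QuatAdelicMatrixModel
open Summit.HodgeConjecture.HodgeConjecture.Cruxes.H413.K2E5QuatZeta
open Summit.HodgeConjecture.HodgeConjecture.Cruxes.H413.K2E5QuatAdelicCoordinates
open Summit.HodgeConjecture.HodgeConjecture.Cruxes.H413.K2E5QuatPoissonDilation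
open scoped Matrix MatrixGroups SchwartzMap Classical

/-! ## §1 `𝒮(𝔸_K^ι)` is stable under invertible `𝔸_K`-linear changes of variables -/

section Generic

variable (K : Type) [Field K] [NumberField K] {ι : Type} [Fintype ι] [DecidableEq ι]

omit [Fintype ι] [DecidableEq ι] in
/-- The archimedean coordinates are the entrywise ★ `archHom`: `piArch v = archHom ∘ v`. [folklore] -/
theorem piArch_eq_comp_archHom (v : ι → AdeleRing (𝓞 K) K) : piArch K ι v = archHom K ∘ v := rfl

omit [DecidableEq ι] in
/-- **`piArch (M v) = M_∞ (piArch v)`** with `M_∞ = M.map archHom` (Mathlib `RingHom.map_mulVec`). [folklore] -/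
theorem piArch_mulVec (M : Matrix ι ι (AdeleRing (𝓞 K) K)) (v : ι → AdeleRing (𝓞 K) K) :
    piArch K ι (M *ᵥ v) = M.map (archHom K) *ᵥ piArch K ι v := by
  funext i
  rw [piArch_eq_comp_archHom, piArch_eq_comp_archHom, Function.comp_apply, RingHom.map_mulVec]

/-- **The factorizable Schwartz–Bruhat functions on `𝔸_K^ι` are stable under `v ↦ M v` for invertible `M ∈ M_ι(𝔸_K)`**: `(Φ_∞ ⊗ Φ_f)(M v) =
(Φ_∞ ∘ M_∞)(piArch v) · (Φ_f ∘ M_f)(piFinite v)` with `Φ_∞ ∘ M_∞` Schwartz (Mathlib `SchwartzMap.compCLMOfContinuousLinearEquiv` for the ℝ-linear automorphism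
`M_∞` of `(K ⊗ ℝ)^ι`) and `Φ_f ∘ M_f` locally constant of compact support (`M_f` is a homeomorphism of `(𝔸_K^∞)^ι`).  (Weil's standard functions are stable
under automorphisms of `X_A`.) [cite: WeilBNT1967, Ch. VII §2 Prop. 2] -/
theorem IsFactorizablePiSchwartzBruhat.comp_mulVec {Φ : (ι → AdeleRing (𝓞 K) K) → ℂ} (h : IsFactorizablePiSchwartzBruhat K ι Φ)
    (M Minv : Matrix ι ι (AdeleRing (𝓞 K) K)) (hM : M * Minv = 1) (hM' : Minv * M = 1) :
    IsFactorizablePiSchwartzBruhat K ι fun v => Φ (M *ᵥ v) := by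
  obtain ⟨Φinf, Φfin, hfin, rfl⟩ := h
  -- archimedean part: the ℝ-linear automorphism `v ↦ M_∞ v` of `(K ⊗ ℝ)^ι`
  set A : Matrix ι ι (mixedSpace K) := M.map (archHom K) with hA
  set Ainv : Matrix ι ι (mixedSpace K) := Minv.map (archHom K) with hAinv
  have hAA : A * Ainv = 1 := by rw [hA, hAinv, ← Matrix.map_mul, hM, Matrix.map_one _ (map_zero _) (map_one _)]
  have hAA' : Ainv * A = 1 := by rw [hA, hAinv, ← Matrix.map_mul, hM', Matrix.map_one _ (map_zero _) (map_one _)]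
  let eA : (ι → mixedSpace K) ≃L[ℝ] (ι → mixedSpace K) :=
    LinearEquiv.toContinuousLinearEquiv
      { toFun := fun w => A *ᵥ w
        invFun := fun w => Ainv *ᵥ w
        map_add' := fun w w' => Matrix.mulVec_add A w w'
        map_smul' := fun c w => Matrix.mulVec_smul A c w
        left_inv := fun w => by
          change Ainv *ᵥ (A *ᵥ w) = w
          rw [Matrix.mulVec_mulVec, hAA', Matrix.one_mulVec]
        right_inv := fun w => by
          change A *ᵥ (Ainv *ᵥ w) = w
          rw [Matrix.mulVec_mulVec, hAA, Matrix.one_mulVec] }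
  -- finite part: the homeomorphism `v ↦ M_f v` of `(𝔸_K^∞)^ι` (`sndA` = the finite-adele component, a ring homomorphism)
  let sndA : AdeleRing (𝓞 K) K →+* FiniteAdeleRing (𝓞 K) K :=
    { toFun := fun a => a.2
      map_one' := rfl
      map_mul' := fun _ _ => rfl
      map_zero' := rfl
      map_add' := fun _ _ => rfl }
  have hpiF : ∀ v : ι → AdeleRing (𝓞 K) K, piFinite K ι v = sndA ∘ v := fun v => rfl
  have hpiF_mulVec : ∀ v : ι → AdeleRing (𝓞 K) K, piFinite K ι (M *ᵥ v) = M.map sndA *ᵥ piFinite K ι v := by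
    intro v
    funext i
    rw [hpiF, hpiF, Function.comp_apply, RingHom.map_mulVec]
  set F : Matrix ι ι (FiniteAdeleRing (𝓞 K) K) := M.map sndA with hF
  set Finv : Matrix ι ι (FiniteAdeleRing (𝓞 K) K) := Minv.map sndA with hFinv
  have hFF : F * Finv = 1 := by rw [hF, hFinv, ← Matrix.map_mul, hM, Matrix.map_one _ (map_zero _) (map_one _)]
  have hFF' : Finv * F = 1 := by rw [hF, hFinv, ← Matrix.map_mul, hM', Matrix.map_one _ (map_zero _) (map_one _)]
  let eF : (ι → FiniteAdeleRing (𝓞 K) K) ≃ₜ (ι → FiniteAdeleRing (𝓞 K) K) :=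
    { toFun := fun w => F *ᵥ w
      invFun := fun w => Finv *ᵥ w
      left_inv := fun w => by
        change Finv *ᵥ (F *ᵥ w) = w
        rw [Matrix.mulVec_mulVec, hFF', Matrix.one_mulVec]
      right_inv := fun w => by
        change F *ᵥ (Finv *ᵥ w) = w
        rw [Matrix.mulVec_mulVec, hFF, Matrix.one_mulVec]
      continuous_toFun := continuous_const.matrix_mulVec continuous_id
      continuous_invFun := continuous_const.matrix_mulVec continuous_id }
  refine ⟨SchwartzMap.compCLMOfContinuousLinearEquiv ℂ eA Φinf, fun w => Φfin (F *ᵥ w), ?_, ?_⟩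
  · obtain ⟨hlc, hcs⟩ := (mem_schwartzBruhat_iff).1 hfin
    exact (mem_schwartzBruhat_iff).2 ⟨hlc.comp_continuous eF.continuous, hcs.comp_homeomorph eF⟩
  · funext v
    change Φinf (piArch K ι (M *ᵥ v)) * Φfin (piFinite K ι (M *ᵥ v)) = _
    rw [piArch_mulVec, hpiF_mulVec]
    rfl

/-- **`𝒮(𝔸_K^ι)` is stable under invertible `𝔸_K`-linear changes of variables**: for `Φ ∈ piSchwartzBruhat K ι` and `M` invertible,
`(v ↦ Φ(M v)) ∈ piSchwartzBruhat K ι` (from the generators by linearity). [cite: WeilBNT1967, Ch. VII §2 Prop. 2] -/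
theorem comp_mulVec_mem_piSchwartzBruhat {Φ : (ι → AdeleRing (𝓞 K) K) → ℂ} (hΦ : Φ ∈ piSchwartzBruhat K ι)
    (M Minv : Matrix ι ι (AdeleRing (𝓞 K) K)) (hM : M * Minv = 1) (hM' : Minv * M = 1) :
    (fun v => Φ (M *ᵥ v)) ∈ piSchwartzBruhat K ι := by
  induction hΦ using Submodule.span_induction with
  | mem Φ h => exact mem_piSchwartzBruhat (IsFactorizablePiSchwartzBruhat.comp_mulVec K h M Minv hM hM')
  | zero => exact zero_mem _
  | add Φ Ψ _ _ ihΦ ihΨ => exact add_mem ihΦ ihΨ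
  | smul c Φ _ ih => exact Submodule.smul_mem _ c ih

/-- **Linear-map form**: for an `𝔸_K`-linear automorphism `T` of `𝔸_K^ι`, `Φ ∘ T ∈ 𝒮(𝔸_K^ι)` whenever `Φ ∈ 𝒮(𝔸_K^ι)` (`T v = [T] v` for the matrix
`[T] = LinearMap.toMatrix' T`, Mathlib `LinearMap.toMatrix'_mulVec`). [cite: WeilBNT1967, Ch. VII §2 Prop. 2] -/
theorem comp_linearEquiv_mem_piSchwartzBruhat {Φ : (ι → AdeleRing (𝓞 K) K) → ℂ} (hΦ : Φ ∈ piSchwartzBruhat K ι)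
    (T : (ι → AdeleRing (𝓞 K) K) ≃ₗ[AdeleRing (𝓞 K) K] (ι → AdeleRing (𝓞 K) K)) :
    (fun v => Φ (T v)) ∈ piSchwartzBruhat K ι := by
  have hM : LinearMap.toMatrix' (T : (ι → AdeleRing (𝓞 K) K) →ₗ[AdeleRing (𝓞 K) K] (ι → AdeleRing (𝓞 K) K)) *
      LinearMap.toMatrix' (T.symm : (ι → AdeleRing (𝓞 K) K) →ₗ[AdeleRing (𝓞 K) K] (ι → AdeleRing (𝓞 K) K)) = 1 := by
    rw [← LinearMap.toMatrix'_comp, LinearEquiv.comp_coe, LinearEquiv.symm_trans_self, LinearEquiv.refl_toLinearMap, LinearMap.toMatrix'_id]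
  have hM' : LinearMap.toMatrix' (T.symm : (ι → AdeleRing (𝓞 K) K) →ₗ[AdeleRing (𝓞 K) K] (ι → AdeleRing (𝓞 K) K)) *
      LinearMap.toMatrix' (T : (ι → AdeleRing (𝓞 K) K) →ₗ[AdeleRing (𝓞 K) K] (ι → AdeleRing (𝓞 K) K)) = 1 := by
    rw [← LinearMap.toMatrix'_comp, LinearEquiv.comp_coe, LinearEquiv.self_trans_symm, LinearEquiv.refl_toLinearMap, LinearMap.toMatrix'_id]
  have h := comp_mulVec_mem_piSchwartzBruhat K hΦ _ _ hM hM'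
  have hfun : (fun v => Φ (LinearMap.toMatrix' (T : (ι → AdeleRing (𝓞 K) K) →ₗ[AdeleRing (𝓞 K) K] (ι → AdeleRing (𝓞 K) K)) *ᵥ v)) =
      fun v => Φ (T v) := by
    funext v
    rw [LinearMap.toMatrix'_mulVec]
    rfl
  rwa [hfun] at h

end Generic

/-! ## §2 The quaternion algebra: `Φ ↦ Φ(x · )` preserves `𝒮(D_{h,𝔸})` -/

section Quat

variable (L : Type) [Field L] [NumberField L] [IsCMField L] {Ha : Matrix (Fin 2) (Fin 2) L}

/-- **`quatCoordInv` is additive on `D_{h,𝔸}`** (it is the inverse of the additive isomorphism ★ `quatCoordEquiv` there). [folklore] -/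
theorem quatCoordInv_add (hHa : (Ha.map (cmConjRingHom L)).transpose = Ha) (hdet : Ha.det ≠ 0)
    {X Y : Matrix (Fin 2) (Fin 2) (AdeleRing (𝓞 L) L)} (hX : X ∈ quatAdelic L Ha) (hY : Y ∈ quatAdelic L Ha) :
    quatCoordInv L hHa hdet (X + Y) = quatCoordInv L hHa hdet X + quatCoordInv L hHa hdet Y := by
  apply quatCoord_injective L hHa hdet
  rw [map_add, quatCoord_quatCoordInv L hHa hdet hX, quatCoord_quatCoordInv L hHa hdet hY,
    quatCoord_quatCoordInv L hHa hdet ((quatAdelic L Ha).add_mem hX hY)]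

/-- **`quatCoordInv` is `𝔸⁺`-semilinear on `D_{h,𝔸}`**: `quatCoordInv ((c ⊗ 1) • X) = c • quatCoordInv X` (★ `quatCoord_smul`). [folklore] -/
theorem quatCoordInv_smul (hHa : (Ha.map (cmConjRingHom L)).transpose = Ha) (hdet : Ha.det ≠ 0)
    (c : AdeleRing (𝓞 ↥(maximalRealSubfield L)) ↥(maximalRealSubfield L))
    {X : Matrix (Fin 2) (Fin 2) (AdeleRing (𝓞 L) L)} (hX : X ∈ quatAdelic L Ha) :
    quatCoordInv L hHa hdet (Literature.NumberTheory.Automorphic.AdeleRing.baseChange (↥(maximalRealSubfield L)) L c • X) =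
      c • quatCoordInv L hHa hdet X := by
  apply quatCoord_injective L hHa hdet
  rw [quatCoord_smul, quatCoord_quatCoordInv L hHa hdet hX,
    quatCoord_quatCoordInv L hHa hdet (smul_mem_quatAdelic L Ha (adeleConj_baseChange L c) hX)]

/-- **The coordinate dilation `T_x` is additive.** [folklore] -/
theorem dilate_add (hHa : (Ha.map (cmConjRingHom L)).transpose = Ha) (hdet : Ha.det ≠ 0) (x : ↥(quatAdelicUnits L Ha))
    (a b : Fin 4 → AdeleRing (𝓞 ↥(maximalRealSubfield L)) ↥(maximalRealSubfield L)) :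
    quatCoordInv L hHa hdet (((x : GL (Fin 2) (AdeleRing (𝓞 L) L)) : Matrix (Fin 2) (Fin 2) (AdeleRing (𝓞 L) L)) *
        quatCoord L (fun i => ((quatBasis L Ha hHa hdet i : ↥(quatRatSubalgebra L Ha)) : Matrix (Fin 2) (Fin 2) L)) (a + b)) =
      quatCoordInv L hHa hdet (((x : GL (Fin 2) (AdeleRing (𝓞 L) L)) : Matrix (Fin 2) (Fin 2) (AdeleRing (𝓞 L) L)) *
          quatCoord L (fun i => ((quatBasis L Ha hHa hdet i : ↥(quatRatSubalgebra L Ha)) : Matrix (Fin 2) (Fin 2) L)) a) +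
        quatCoordInv L hHa hdet (((x : GL (Fin 2) (AdeleRing (𝓞 L) L)) : Matrix (Fin 2) (Fin 2) (AdeleRing (𝓞 L) L)) *
          quatCoord L (fun i => ((quatBasis L Ha hHa hdet i : ↥(quatRatSubalgebra L Ha)) : Matrix (Fin 2) (Fin 2) L)) b) := by
  rw [map_add, Matrix.mul_add]
  exact quatCoordInv_add L hHa hdet
    ((quatAdelic L Ha).mul_mem (coe_coe_mem_quatAdelic L x) (quatCoord_mem_quatAdelic L Ha (coe_quatBasis_mem L Ha hHa hdet) a))
    ((quatAdelic L Ha).mul_mem (coe_coe_mem_quatAdelic L x) (quatCoord_mem_quatAdelic L Ha (coe_quatBasis_mem L Ha hHa hdet) b))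

/-- **The coordinate dilation `T_x` is `𝔸⁺`-homogeneous** (`x · ((c ⊗ 1) • Y) = (c ⊗ 1) • (x · Y)`: scalars are central). [folklore] -/
theorem dilate_smul (hHa : (Ha.map (cmConjRingHom L)).transpose = Ha) (hdet : Ha.det ≠ 0) (x : ↥(quatAdelicUnits L Ha))
    (c : AdeleRing (𝓞 ↥(maximalRealSubfield L)) ↥(maximalRealSubfield L))
    (a : Fin 4 → AdeleRing (𝓞 ↥(maximalRealSubfield L)) ↥(maximalRealSubfield L)) :
    quatCoordInv L hHa hdet (((x : GL (Fin 2) (AdeleRing (𝓞 L) L)) : Matrix (Fin 2) (Fin 2) (AdeleRing (𝓞 L) L)) *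
        quatCoord L (fun i => ((quatBasis L Ha hHa hdet i : ↥(quatRatSubalgebra L Ha)) : Matrix (Fin 2) (Fin 2) L)) (c • a)) =
      c • quatCoordInv L hHa hdet (((x : GL (Fin 2) (AdeleRing (𝓞 L) L)) : Matrix (Fin 2) (Fin 2) (AdeleRing (𝓞 L) L)) *
          quatCoord L (fun i => ((quatBasis L Ha hHa hdet i : ↥(quatRatSubalgebra L Ha)) : Matrix (Fin 2) (Fin 2) L)) a) := by
  rw [quatCoord_smul, Matrix.mul_smul]
  exact quatCoordInv_smul L hHa hdet c
    ((quatAdelic L Ha).mul_mem (coe_coe_mem_quatAdelic L x) (quatCoord_mem_quatAdelic L Ha (coe_quatBasis_mem L Ha hHa hdet) a))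

/-- **`𝒮(D_{h,𝔸})` IS STABLE UNDER `Φ ↦ Φ(x · )`** for every unit `x ∈ (D_h ⊗ 𝔸)^×`: if `Φ ∈ quatSchwartzBruhat L e` (★ #3g: `Φ ∘ quatCoord e ∈ 𝒮(𝔸⁺⁴)`) then
`(X ↦ Φ(x · X)) ∈ quatSchwartzBruhat L e` — in coordinates, `Φ(x · quatCoord e a) = (Φ ∘ quatCoord e)(T_x a)` (★ `quatCoord_dilate`) with `T_x` an
`𝔸⁺`-linear automorphism of `𝔸⁺⁴` (`dilate_add`, `dilate_smul`, inverse `T_{x⁻¹}`: ★ `dilate_inv_dilate`), so §1 applies.  With ★ ED. 1∕ED. 2 this is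
everything Tate's unfolding of the zeta integral of `D_h` asks of the test function. [cite: WeilBNT1967, Ch. VII §2 Prop. 2] [cite: VignerasLNM800, Ch. III §2 (proof of Thm. 2.2)] -/
theorem comp_mul_left_mem_quatSchwartzBruhat (hHa : (Ha.map (cmConjRingHom L)).transpose = Ha) (hdet : Ha.det ≠ 0)
    (x : ↥(quatAdelicUnits L Ha)) {Φ : Matrix (Fin 2) (Fin 2) (AdeleRing (𝓞 L) L) → ℂ}
    (hΦ : Φ ∈ quatSchwartzBruhat L (fun i => ((quatBasis L Ha hHa hdet i : ↥(quatRatSubalgebra L Ha)) : Matrix (Fin 2) (Fin 2) L))) :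
    (fun X => Φ (((x : GL (Fin 2) (AdeleRing (𝓞 L) L)) : Matrix (Fin 2) (Fin 2) (AdeleRing (𝓞 L) L)) * X)) ∈
      quatSchwartzBruhat L (fun i => ((quatBasis L Ha hHa hdet i : ↥(quatRatSubalgebra L Ha)) : Matrix (Fin 2) (Fin 2) L)) := by
  -- `T_x` as an `𝔸⁺`-linear automorphism of `𝔸⁺⁴`
  let T : (Fin 4 → AdeleRing (𝓞 ↥(maximalRealSubfield L)) ↥(maximalRealSubfield L)) ≃ₗ[AdeleRing (𝓞 ↥(maximalRealSubfield L)) ↥(maximalRealSubfield L)]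
      (Fin 4 → AdeleRing (𝓞 ↥(maximalRealSubfield L)) ↥(maximalRealSubfield L)) :=
    { toFun := fun a => quatCoordInv L hHa hdet (((x : GL (Fin 2) (AdeleRing (𝓞 L) L)) : Matrix (Fin 2) (Fin 2) (AdeleRing (𝓞 L) L)) *
        quatCoord L (fun i => ((quatBasis L Ha hHa hdet i : ↥(quatRatSubalgebra L Ha)) : Matrix (Fin 2) (Fin 2) L)) a)
      invFun := fun a => quatCoordInv L hHa hdet (((x⁻¹ : ↥(quatAdelicUnits L Ha)) : GL (Fin 2) (AdeleRing (𝓞 L) L)) *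
        quatCoord L (fun i => ((quatBasis L Ha hHa hdet i : ↥(quatRatSubalgebra L Ha)) : Matrix (Fin 2) (Fin 2) L)) a)
      map_add' := fun a b => dilate_add L hHa hdet x a b
      map_smul' := fun c a => dilate_smul L hHa hdet x c a
      left_inv := fun a => dilate_inv_dilate L hHa hdet x a
      right_inv := fun a => dilate_dilate_inv L hHa hdet x a }
  rw [mem_quatSchwartzBruhat_iff] at hΦ ⊢
  have h := comp_linearEquiv_mem_piSchwartzBruhat (↥(maximalRealSubfield L)) hΦ T
  have hfun : (fun a => Φ (quatCoord L (fun i => ((quatBasis L Ha hHa hdet i : ↥(quatRatSubalgebra L Ha)) : Matrix (Fin 2) (Fin 2) L)) (T a))) =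
      fun a => Φ (((x : GL (Fin 2) (AdeleRing (𝓞 L) L)) : Matrix (Fin 2) (Fin 2) (AdeleRing (𝓞 L) L)) *
        quatCoord L (fun i => ((quatBasis L Ha hHa hdet i : ↥(quatRatSubalgebra L Ha)) : Matrix (Fin 2) (Fin 2) L)) a) := by
    funext a
    exact congrArg Φ (quatCoord_dilate L hHa hdet x a)
  rwa [hfun] at h

end Quat

end Summit.HodgeConjecture.HodgeConjecture.Cruxes.H413.K2E5QuatSchwartzBruhatDilate

end
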